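import Summits.QuantumAdvantage.QuantumAdvantage.Theorems.SosSandwichPseudoBoundedAAChebyshevFamily
import Mathlib.Analysis.SpecialFunctions.Trigonometric.Inverse

/-!
# Route `SosSandwich`, crux `PseudoBoundedAA` (stmt-QuantumAdvantage-15237) — variance floor of the
Chebyshev family `p_k = T_k(ȳ)²`, reduced to a binomial two-window count

Helper (`--supports stmt-QuantumAdvantage-15237`), conjecture-free, no named facts; continues
`SosSandwichPseudoBoundedAAChebyshevFamily.lean` (`p_k ∈ K_k`, `p_k = cos²(k·arccos ȳ)`) and
`SosSandwichPseudoBoundedAAChebyshevInfluence.lean` (`Infᵢ[p_k] ≤ 4/N + 25k²/N²`).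

* §1 `boolAvg_sq_sub_avg_ge_two_window` — a two-window variance floor on the cube: `f ≥ a` on `A`,
  `f ≤ b` on `B`, `b ≤ a` ⟹ `Var f ≥ ((a−b)/2)²·min(P A, P B)`.
* §2 the two PHASE WINDOWS of the amplitude-amplification profile for `k ≡ 0 (mod 4)`
  (`cos(k·arccos y) = cos(k·arcsin y)`): `|y| ≤ sin(π/(6k)) ⟹ cos²(k·arccos y) ≥ 3/4`
  (`cos_sq_arccos_ge_of_abs_le`) and `sin(π/(3k)) ≤ |y| ≤ sin(2π/(3k)) ⟹ cos²(k·arccos y) ≤ 1/4`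
  (`cos_sq_arccos_le_of_mem_window`) — exact thresholds through `sin`, so no `arcsin` estimates are
  needed downstream.
* §3 `boolVariance_chebyshevT_sq_ge_two_window` — for `k = 4m ≥ 4`, `N ≥ 1`:
  `Var[p_k] ≥ (1/16)·min( P[|ȳ| ≤ sin(π/(6k))], P[sin(π/(3k)) ≤ |ȳ| ≤ sin(2π/(3k))] )`.

CALIBRATION STATUS (`T`-side, law `maxInf ≥ C·Var^a/T^b` on `K`): with the two previous files, the
kernel statement "`b ≥ 2`" (equivalently: the top-homogeneous corner law `maxInf ≥ C·Var²/T` FAILS on the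
full class `K`) is now reduced to ONE purely binomial estimate (R1′, size S/M, CLT-free): at `N = k²`
(`k = 4m ≥ k₀`) both windows have probability `≥ δ₀ > 0` under the uniform cube measure — the central
window is `|Σᵢ yᵢ| ≤ k²·sin(π/(6k))` (`≈ 0.52` standard deviations of `Σ yᵢ`, numerically `P ≈ 0.40`), the
off-centre one `k²·sin(π/(3k)) ≤ |Σ yᵢ| ≤ k²·sin(2π/(3k))` (`≈ 1.05 … 2.09` standard deviations,
`P ≈ 0.26`); elementary route: `#{x : wt x = j} = C(N, j)`, `C(2n, n)/4^n ≥ 1/(2√n)` (induction: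
`C(2n,n)²·4n ≥ 16^n`) and `C(2n, n+t) ≥ (1 − t²/n)·C(2n, n)` for `|t| ≤ √n` (telescoping ratio), summed
over the integer points of each window. Then `Var[p_k] ≥ δ₀/16` while `maxInf ≤ 29/k²` (`b ≥ 2`).

Sources: amplitude amplification / polynomial method [cite: BealsEtAl2001, §4]; the class `K_T`
[cite: KaniewskiLeeDewolf2015, Def. 7]; elementary trigonometry [folklore].
-/

set_option linter.dupNamespace false

noncomputable section

namespace Summit.QuantumAdvantage.QuantumAdvantage.Theorems.SosSandwich

open Finset
open Literature.Computability.QuantumComplexity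

variable {N : ℕ}

/-! ### §1 A two-window variance floor on the cube -/

/-- **Two-window variance floor.** If `f ≥ a` on the event `A` and `f ≤ b` on the event `B` with
`b ≤ a`, then `Var f ≥ ((a − b)/2)² · min(P A, P B)` (whichever side of `(a+b)/2` the mean falls, one of
the two events is at distance `≥ (a − b)/2` from it). [folklore] -/
theorem boolAvg_sq_sub_avg_ge_two_window (f : (Fin N → Bool) → ℝ) (A B : (Fin N → Bool) → Prop)
    [DecidablePred A] [DecidablePred B] {a b : ℝ} (hab : b ≤ a)
    (hA : ∀ x, A x → a ≤ f x) (hB : ∀ x, B x → f x ≤ b) :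
    ((a - b) / 2) ^ 2 * min (boolAvg (fun x => if A x then (1 : ℝ) else 0))
        (boolAvg (fun x => if B x then (1 : ℝ) else 0)) ≤
      boolAvg (fun x => (f x - boolAvg f) ^ 2) := by
  set μ := boolAvg f with hμ
  have hPA : 0 ≤ boolAvg (fun x => if A x then (1 : ℝ) else 0) :=
    boolAvg_nonneg fun x => by split_ifs <;> norm_num
  have hPB : 0 ≤ boolAvg (fun x => if B x then (1 : ℝ) else 0) :=
    boolAvg_nonneg fun x => by split_ifs <;> norm_num
  rcases le_total μ ((a + b) / 2) with hle | hge
  · -- the mean is low: the event `A` is far above it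
    have hpt : ∀ x, ((a - b) / 2) ^ 2 * (if A x then (1 : ℝ) else 0) ≤ (f x - μ) ^ 2 := by
      intro x
      split_ifs with hx
      · have h1 : (a - b) / 2 ≤ f x - μ := by linarith [hA x hx]
        have h0 : 0 ≤ (a - b) / 2 := by linarith
        rw [mul_one]; exact pow_le_pow_left₀ h0 h1 2
      · rw [mul_zero]; exact sq_nonneg _
    have havg : boolAvg (fun x => ((a - b) / 2) ^ 2 * (if A x then (1 : ℝ) else 0)) ≤
        boolAvg (fun x => (f x - μ) ^ 2) := by
      have := boolAvg_nonneg (f := fun x => (f x - μ) ^ 2 - ((a - b) / 2) ^ 2 * (if A x then (1 : ℝ) else 0))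
        fun x => sub_nonneg.mpr (hpt x)
      rw [avg_sub] at this; linarith
    rw [avg_const_mul] at havg
    calc ((a - b) / 2) ^ 2 * min (boolAvg (fun x => if A x then (1 : ℝ) else 0))
          (boolAvg (fun x => if B x then (1 : ℝ) else 0))
        ≤ ((a - b) / 2) ^ 2 * boolAvg (fun x => if A x then (1 : ℝ) else 0) :=
          mul_le_mul_of_nonneg_left (min_le_left _ _) (sq_nonneg _)
      _ ≤ _ := havg
  · -- the mean is high: the event `B` is far below it
    have hpt : ∀ x, ((a - b) / 2) ^ 2 * (if B x then (1 : ℝ) else 0) ≤ (f x - μ) ^ 2 := by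
      intro x
      split_ifs with hx
      · have h1 : (a - b) / 2 ≤ μ - f x := by linarith [hB x hx]
        have h0 : 0 ≤ (a - b) / 2 := by linarith
        rw [mul_one, show (f x - μ) ^ 2 = (μ - f x) ^ 2 by ring]
        exact pow_le_pow_left₀ h0 h1 2
      · rw [mul_zero]; exact sq_nonneg _
    have havg : boolAvg (fun x => ((a - b) / 2) ^ 2 * (if B x then (1 : ℝ) else 0)) ≤
        boolAvg (fun x => (f x - μ) ^ 2) := by
      have := boolAvg_nonneg (f := fun x => (f x - μ) ^ 2 - ((a - b) / 2) ^ 2 * (if B x then (1 : ℝ) else 0))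
        fun x => sub_nonneg.mpr (hpt x)
      rw [avg_sub] at this; linarith
    rw [avg_const_mul] at havg
    calc ((a - b) / 2) ^ 2 * min (boolAvg (fun x => if A x then (1 : ℝ) else 0))
          (boolAvg (fun x => if B x then (1 : ℝ) else 0))
        ≤ ((a - b) / 2) ^ 2 * boolAvg (fun x => if B x then (1 : ℝ) else 0) :=
          mul_le_mul_of_nonneg_left (min_le_right _ _) (sq_nonneg _)
      _ ≤ _ := havg

/-! ### §2 The two phase windows of `cos²(k · arccos ȳ)` for `k ≡ 0 (mod 4)` -/

/-- For `k = 4m`: `cos(k · arccos y) = cos(k · arcsin y)` (`arccos = π/2 − arcsin`, `cos` is `2π`-periodic).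
[folklore] -/
theorem cos_four_mul_arccos (m : ℕ) (y : ℝ) :
    Real.cos ((4 * m : ℕ) * Real.arccos y) = Real.cos ((4 * m : ℕ) * Real.arcsin y) := by
  rw [Real.arccos_eq_pi_div_two_sub_arcsin]
  have : ((4 * m : ℕ) : ℝ) * (Real.pi / 2 - Real.arcsin y) =
      (m : ℕ) * (2 * Real.pi) - ((4 * m : ℕ) : ℝ) * Real.arcsin y := by push_cast; ring
  rw [this, Real.cos_nat_mul_two_pi_sub]

/-- CENTRAL WINDOW: if `|y| ≤ sin(π/(6k))` (`k = 4m ≥ 4`) then `cos²(k · arccos y) ≥ 3/4`. [folklore] -/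
theorem cos_sq_arccos_ge_of_abs_le (m : ℕ) (hm : 1 ≤ m) {y : ℝ}
    (hy : |y| ≤ Real.sin (Real.pi / (6 * (4 * m : ℕ)))) :
    3 / 4 ≤ Real.cos ((4 * m : ℕ) * Real.arccos y) ^ 2 := by
  have hk : (4 : ℝ) ≤ ((4 * m : ℕ) : ℝ) := by exact_mod_cast (show 4 ≤ 4 * m by omega)
  have hkpos : (0 : ℝ) < ((4 * m : ℕ) : ℝ) := by linarith
  have hpi := Real.pi_pos
  rw [cos_four_mul_arccos]
  -- `|arcsin y| ≤ π/(6k)`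
  have hθ : 0 < Real.pi / (6 * (4 * m : ℕ)) := by positivity
  have hθ2 : Real.pi / (6 * (4 * m : ℕ)) ≤ Real.pi / 2 := by
    rw [div_le_iff₀ (by positivity)]; nlinarith
  have habs : |Real.arcsin y| ≤ Real.pi / (6 * (4 * m : ℕ)) := by
    rw [abs_le]
    constructor
    · have h1 : Real.arcsin (-Real.sin (Real.pi / (6 * (4 * m : ℕ)))) ≤ Real.arcsin y :=
        Real.monotone_arcsin (by linarith [(abs_le.mp hy).1])
      rwa [Real.arcsin_neg, Real.arcsin_sin (by linarith) hθ2] at h1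
    · have h1 : Real.arcsin y ≤ Real.arcsin (Real.sin (Real.pi / (6 * (4 * m : ℕ)))) :=
        Real.monotone_arcsin (abs_le.mp hy).2
      rwa [Real.arcsin_sin (by linarith) hθ2] at h1
  -- `|k · arcsin y| ≤ π/6`, so `cos ≥ cos(π/6) = √3/2`
  have hu : |((4 * m : ℕ) : ℝ) * Real.arcsin y| ≤ Real.pi / 6 := by
    rw [abs_mul, abs_of_pos hkpos]
    calc ((4 * m : ℕ) : ℝ) * |Real.arcsin y| ≤ ((4 * m : ℕ) : ℝ) * (Real.pi / (6 * (4 * m : ℕ))) :=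
          mul_le_mul_of_nonneg_left habs hkpos.le
      _ = Real.pi / 6 := by field_simp
  have hcos : Real.sqrt 3 / 2 ≤ Real.cos (((4 * m : ℕ) : ℝ) * Real.arcsin y) := by
    rw [← Real.cos_abs, ← Real.cos_pi_div_six]
    exact Real.cos_le_cos_of_nonneg_of_le_pi (abs_nonneg _) (by linarith) hu
  have h3 : (Real.sqrt 3 / 2) ^ 2 = 3 / 4 := by
    rw [div_pow, Real.sq_sqrt (by norm_num)]; norm_num
  rw [← h3]
  exact pow_le_pow_left₀ (by positivity) hcos 2

/-- OFF-CENTRE WINDOW: if `sin(π/(3k)) ≤ |y| ≤ sin(2π/(3k))` (`k = 4m ≥ 4`) then `cos²(k · arccos y) ≤ 1/4`.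
[folklore] -/
theorem cos_sq_arccos_le_of_mem_window (m : ℕ) (hm : 1 ≤ m) {y : ℝ}
    (hy1 : Real.sin (Real.pi / (3 * (4 * m : ℕ))) ≤ |y|)
    (hy2 : |y| ≤ Real.sin (2 * Real.pi / (3 * (4 * m : ℕ)))) :
    Real.cos ((4 * m : ℕ) * Real.arccos y) ^ 2 ≤ 1 / 4 := by
  have hk : (4 : ℝ) ≤ ((4 * m : ℕ) : ℝ) := by exact_mod_cast (show 4 ≤ 4 * m by omega)
  have hkpos : (0 : ℝ) < ((4 * m : ℕ) : ℝ) := by linarith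
  have hpi := Real.pi_pos
  rw [cos_four_mul_arccos]
  -- reduce to `|y|`: `cos(k·arcsin y) = cos(k·arcsin |y|)`
  have heven : Real.cos (((4 * m : ℕ) : ℝ) * Real.arcsin y) =
      Real.cos (((4 * m : ℕ) : ℝ) * Real.arcsin |y|) := by
    rcases le_total 0 y with h | h
    · rw [abs_of_nonneg h]
    · rw [abs_of_nonpos h, Real.arcsin_neg, mul_neg, Real.cos_neg]
  rw [heven]
  have hθpos : 0 < Real.pi / (3 * (4 * m : ℕ)) := by positivity
  have hθpos2 : 0 < 2 * Real.pi / (3 * (4 * m : ℕ)) := by positivity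
  have hθ2 : 2 * Real.pi / (3 * (4 * m : ℕ)) ≤ Real.pi / 2 := by
    rw [div_le_iff₀ (by positivity)]; nlinarith
  have hθ1 : Real.pi / (3 * (4 * m : ℕ)) ≤ Real.pi / 2 := by
    rw [div_le_iff₀ (by positivity)]; nlinarith
  -- `π/(3k) ≤ arcsin |y| ≤ 2π/(3k)`
  have hlo : Real.pi / (3 * (4 * m : ℕ)) ≤ Real.arcsin |y| := by
    have h1 := Real.monotone_arcsin hy1
    rwa [Real.arcsin_sin (by linarith) hθ1] at h1
  have hhi : Real.arcsin |y| ≤ 2 * Real.pi / (3 * (4 * m : ℕ)) := by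
    have h1 := Real.monotone_arcsin hy2
    rwa [Real.arcsin_sin (by linarith) hθ2] at h1
  -- `π/3 ≤ k·arcsin|y| ≤ 2π/3`
  have hu1 : Real.pi / 3 ≤ ((4 * m : ℕ) : ℝ) * Real.arcsin |y| := by
    calc Real.pi / 3 = ((4 * m : ℕ) : ℝ) * (Real.pi / (3 * (4 * m : ℕ))) := by field_simp
      _ ≤ _ := mul_le_mul_of_nonneg_left hlo hkpos.le
  have hu2 : ((4 * m : ℕ) : ℝ) * Real.arcsin |y| ≤ 2 * Real.pi / 3 := by
    calc ((4 * m : ℕ) : ℝ) * Real.arcsin |y| ≤ ((4 * m : ℕ) : ℝ) * (2 * Real.pi / (3 * (4 * m : ℕ))) :=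
          mul_le_mul_of_nonneg_left hhi hkpos.le
      _ = 2 * Real.pi / 3 := by field_simp
  set u := ((4 * m : ℕ) : ℝ) * Real.arcsin |y| with hu
  -- `|cos u| ≤ 1/2` on `[π/3, 2π/3]`
  have hup : Real.cos u ≤ 1 / 2 := by
    rw [← Real.cos_pi_div_three]
    exact Real.cos_le_cos_of_nonneg_of_le_pi (by positivity) (by linarith) hu1
  have hdown : -(1 / 2) ≤ Real.cos u := by
    have h1 : Real.cos (Real.pi - Real.pi / 3) ≤ Real.cos u :=
      Real.cos_le_cos_of_nonneg_of_le_pi (by linarith) (by linarith) (by linarith)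
    rw [Real.cos_pi_sub, Real.cos_pi_div_three] at h1
    linarith
  have habs : |Real.cos u| ≤ 1 / 2 := abs_le.mpr ⟨hdown, hup⟩
  calc Real.cos u ^ 2 = |Real.cos u| ^ 2 := (sq_abs _).symm
    _ ≤ (1 / 2) ^ 2 := pow_le_pow_left₀ (abs_nonneg _) habs 2
    _ = 1 / 4 := by norm_num

/-! ### §3 The variance floor of the Chebyshev family, reduced to a binomial two-window count -/

/-- **Variance floor of `p_k = T_k(ȳ)²` modulo a two-window count** (`k = 4m ≥ 4`, `N ≥ 1`):
`Var[p_k] ≥ (1/16) · min( P[|ȳ| ≤ sin(π/(6k))], P[sin(π/(3k)) ≤ |ȳ| ≤ sin(2π/(3k))] )`,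
since `p_k = cos²(k·arccos ȳ) ≥ 3/4` on the central window and `≤ 1/4` on the off-centre window.
What remains for the `T`-side calibration `b ≥ 2` is therefore ONLY the binomial estimate that both
windows have probability `≥ δ₀ > 0` at `N = k²` (central window: `|Σᵢ yᵢ| ≤ k²·sin(π/(6k)) ≈ 0.52·k`,
i.e. `≈ 0.52` standard deviations; off-centre: `Σᵢ yᵢ ∈ ±[1.05k, 2.09k]`, i.e. `1.05 … 2.09` standard
deviations — numerically `P ≈ 0.40` and `0.26`). [folklore] -/
theorem boolVariance_chebyshevT_sq_ge_two_window (m : ℕ) (hm : 1 ≤ m) (hN : 1 ≤ N) :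
    (1 / 16 : ℝ) * min
        (boolAvg (fun x : Fin N → Bool =>
          if |(1 / (N : ℝ)) * ∑ i, (1 - 2 * (if x i then (1 : ℝ) else 0))| ≤
              Real.sin (Real.pi / (6 * (4 * m : ℕ))) then (1 : ℝ) else 0))
        (boolAvg (fun x : Fin N → Bool =>
          if Real.sin (Real.pi / (3 * (4 * m : ℕ))) ≤ |(1 / (N : ℝ)) * ∑ i, (1 - 2 * (if x i then (1 : ℝ) else 0))| ∧
              |(1 / (N : ℝ)) * ∑ i, (1 - 2 * (if x i then (1 : ℝ) else 0))| ≤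
                Real.sin (2 * Real.pi / (3 * (4 * m : ℕ))) then (1 : ℝ) else 0)) ≤
      boolVariance ((Polynomial.aeval (∑ i : Fin N, (MvPolynomial.C (1 / (N : ℝ)) -
          MvPolynomial.C (2 / (N : ℝ)) * MvPolynomial.X i)) (Polynomial.Chebyshev.T ℝ ((4 * m : ℕ) : ℤ))) ^ 2) := by
  unfold boolVariance
  have key := boolAvg_sq_sub_avg_ge_two_window
    (evalBool ((Polynomial.aeval (∑ i : Fin N, (MvPolynomial.C (1 / (N : ℝ)) -
          MvPolynomial.C (2 / (N : ℝ)) * MvPolynomial.X i)) (Polynomial.Chebyshev.T ℝ ((4 * m : ℕ) : ℤ))) ^ 2))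
    (fun x : Fin N → Bool => |(1 / (N : ℝ)) * ∑ i, (1 - 2 * (if x i then (1 : ℝ) else 0))| ≤
      Real.sin (Real.pi / (6 * (4 * m : ℕ))))
    (fun x : Fin N → Bool =>
      Real.sin (Real.pi / (3 * (4 * m : ℕ))) ≤ |(1 / (N : ℝ)) * ∑ i, (1 - 2 * (if x i then (1 : ℝ) else 0))| ∧
        |(1 / (N : ℝ)) * ∑ i, (1 - 2 * (if x i then (1 : ℝ) else 0))| ≤ Real.sin (2 * Real.pi / (3 * (4 * m : ℕ))))
    (a := 3 / 4) (b := 1 / 4) (by norm_num)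
    (fun x hx => by
      rw [evalBool_chebyshevT_sq_eq_cos_sq _ hN]
      exact cos_sq_arccos_ge_of_abs_le m hm hx)
    (fun x hx => by
      rw [evalBool_chebyshevT_sq_eq_cos_sq _ hN]
      exact cos_sq_arccos_le_of_mem_window m hm hx.1 hx.2)
  have h16 : ((3 / 4 - 1 / 4 : ℝ) / 2) ^ 2 = 1 / 16 := by norm_num
  rw [h16] at key
  exact key

end Summit.QuantumAdvantage.QuantumAdvantage.Theorems.SosSandwich

end
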